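import Summits.AnomalousDissipation.AnomalousDissipation.Theorems.EnsembleRigidityDefs
import Literature.Analysis.FluidPDE.CylindricalGenerator
import HarnessLib

/-!
# Stub `stub_linearTestLimit` (L) of line `Sketch`
# (crux stmt-AnomalousDissipation-15508, `EnsembleRigidity.GPStatisticalRigidity`)

REMOVING THE CUT-OFF. Let `μ` be a Borel probability measure on the energy space
`H = L²_σ(T³)` with `∫ |v|² dμ < ∞`, `f ∈ L²` a force and `w ∈ 𝒱` a FIXED smooth solenoidal
mean-zero test field. If the cylindrical forced-Euler defect of `μ` is at most `R`, i.e.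
`|∫ ⟨f − B(v,v), Φ'(v)⟩ dμ| ≤ R (∫ ‖∇Φ'(v)‖² dμ)^{1/2}` for EVERY cylindrical test functional
`Φ` (Foias–Manley–Rosa–Temam 2001, Ch. IV §1.2, Def. 1.2; tree structure
`Torus.CylindricalTest`), then the balance against the fixed field holds:
`v ↦ ⟨f − B(v,v), w⟩ = Torus.nsGeneratorPairing 0 f v w` is `μ`-integrable and
`|∫ ⟨f − B(v,v), w⟩ dμ| ≤ R ‖∇w‖₂`.

Proof. `K(v) := ⟨f − B(v,v), w⟩` is continuous on `H` with `|K(v)| ≤ K₀ (1 + |v|²)`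
(`Torus.continuous_nsGeneratorPairing`, `Torus.exists_abs_nsGeneratorPairing_le`), hence
`μ`-integrable. For `s > 0` let `Φ_s` be the cylindrical functional with the single coordinate
`(·, w)` and the profile `φ_s(y) = y₀ χ(s y)`, `χ` a smooth bump on `ℝ¹` with `χ ≡ 1` on the
closed unit ball and support in the ball of radius `2`. Then `Φ_s'(v) = ψ_s((v, w)) w` with
`ψ_s(y) = ∂₀φ_s(y) = χ(s y) + y₀ s χ'(s y)`, so `|ψ_s| ≤ 1 + 2 ‖χ'‖_∞` uniformly in `s > 0` and
`ψ_s(y) = 1` as soon as `s |y| < 1`; moreover `⟨f − B(v,v), Φ_s'(v)⟩ = ψ_s((v,w)) K(v)`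
(`Torus.nsGeneratorPairing_grad`) and `‖∇Φ_s'(v)‖² = ψ_s((v,w))² ‖∇w‖²`. Along `s = 1/(n+1)`
both sides of the defect inequality converge by dominated convergence
(`∫ ψ K dμ → ∫ K dμ`, `∫ ψ² dμ ‖∇w‖² → ‖∇w‖²`), and the inequality passes to the limit.

References: C. Foias, O. Manley, R. Rosa, R. Temam, *Navier–Stokes Equations and Turbulence*
(CUP 2001), Ch. IV §1.2, Def. 1.2–1.3 and (1.30).
-/

set_option linter.dupNamespace false

noncomputable section

namespace Summit.AnomalousDissipation.AnomalousDissipation.Theorems.EnsembleRigidity.GPStatisticalRigidity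

open MeasureTheory Filter Topology UnitAddTorus
open scoped InnerProductSpace RealInnerProductSpace ENNReal NNReal
open Literature.Analysis.FunctionSpaces Literature.Analysis.FluidPDE
open Summit.AnomalousDissipation.AnomalousDissipation.Theorems.EnsembleRigidity

/-- Local notation: real vector fields on `T³`. -/
local notation "Vec3" => (UnitAddTorus (Fin 3)) → (EuclideanSpace ℝ (Fin 3))
/-- Local notation: `L²(T³; ℝ³)`. -/
local notation "L2" => (Lp (EuclideanSpace ℝ (Fin 3)) 2 (volume : Measure (UnitAddTorus (Fin 3))))
/-- Local notation: the energy space `H`. -/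
local notation "H3" => (Torus.energySpace (Fin 3))

/-! ## Scaling of the enstrophy under a constant factor -/

-- adapted from Theorems/MirrorVarietyTaylorGreenLoudGalerkinStatesStubScaling.lean (`gradNormSq_const_smul`,
-- stated there for smooth fields of another crux's namespace); here unconditional, via the
-- regularity-free `Torus.partialDeriv_const_smul_apply`.
/-- `‖∇(c w)‖₂² = c² ‖∇w‖₂²` for a constant `c` (no regularity needed: `∂ᵢ (c w) = c ∂ᵢ w` holds
for the junk values too, `Torus.partialDeriv_const_smul_apply`). [folklore] -/
theorem linearTestLimit_gradNormSq_const_smul (c : ℝ) (w : Vec3) :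
    Torus.gradNormSq (fun x => c • w x) = c ^ 2 * Torus.gradNormSq w := by
  unfold Torus.gradNormSq
  rw [← integral_const_mul]
  refine integral_congr_ae (ae_of_all _ fun x => ?_)
  simp only [Torus.partialDeriv_const_smul_apply, norm_smul, mul_pow, Real.norm_eq_abs, sq_abs,
    Finset.mul_sum]

/-! ## The cut-off profiles `φ_s(y) = y₀ χ(s y)` on `ℝ¹`

Throughout, `χ` is a smooth bump on `ℝ¹ = EuclideanSpace ℝ (Fin 1)` centred at `0`
(`ContDiffBump 0`: `χ ≡ 1` on the closed `rIn`-ball, support in the open `rOut`-ball,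
`0 ≤ χ ≤ 1`), and `ψ_s(y) := ∂₀ φ_s(y)` is the derivative of the profile in the direction `e₀`. -/

/-- `φ_s` is `C¹`. [folklore] -/
theorem linearTestLimit_contDiff_profile (χ : ContDiffBump (0 : EuclideanSpace ℝ (Fin 1))) (s : ℝ) :
    ContDiff ℝ 1 (fun z : EuclideanSpace ℝ (Fin 1) =>
      EuclideanSpace.proj (𝕜 := ℝ) (0 : Fin 1) z * (χ : EuclideanSpace ℝ (Fin 1) → ℝ) (s • z)) :=
  (EuclideanSpace.proj (𝕜 := ℝ) (0 : Fin 1)).contDiff.mul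
    ((χ.contDiff (n := 1)).comp (contDiff_const_smul s))

/-- `φ_s` has compact support for `s ≠ 0`. [folklore] -/
theorem linearTestLimit_hasCompactSupport_profile (χ : ContDiffBump (0 : EuclideanSpace ℝ (Fin 1)))
    {s : ℝ} (hs : s ≠ 0) :
    HasCompactSupport (fun z : EuclideanSpace ℝ (Fin 1) =>
      EuclideanSpace.proj (𝕜 := ℝ) (0 : Fin 1) z * (χ : EuclideanSpace ℝ (Fin 1) → ℝ) (s • z)) :=
  (χ.hasCompactSupport.comp_smul hs).mul_left

/-- The product/chain rule: `ψ_s(y) = χ(s y) + y₀ · s · χ'(s y) e₀`. [folklore] -/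
theorem linearTestLimit_fderiv_profile (χ : ContDiffBump (0 : EuclideanSpace ℝ (Fin 1))) (s : ℝ)
    (y : EuclideanSpace ℝ (Fin 1)) :
    fderiv ℝ (fun z : EuclideanSpace ℝ (Fin 1) =>
        EuclideanSpace.proj (𝕜 := ℝ) (0 : Fin 1) z * (χ : EuclideanSpace ℝ (Fin 1) → ℝ) (s • z)) y
      (EuclideanSpace.single (0 : Fin 1) (1 : ℝ)) =
      (χ : EuclideanSpace ℝ (Fin 1) → ℝ) (s • y) +
        y 0 * (s * fderiv ℝ (χ : EuclideanSpace ℝ (Fin 1) → ℝ) (s • y)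
          (EuclideanSpace.single (0 : Fin 1) (1 : ℝ))) := by
  have ha : DifferentiableAt ℝ
      (EuclideanSpace.proj (𝕜 := ℝ) (0 : Fin 1) : EuclideanSpace ℝ (Fin 1) → ℝ) y :=
    (EuclideanSpace.proj (𝕜 := ℝ) (0 : Fin 1)).differentiableAt
  have hb : DifferentiableAt ℝ
      (fun z : EuclideanSpace ℝ (Fin 1) => (χ : EuclideanSpace ℝ (Fin 1) → ℝ) (s • z)) y :=
    (((χ.contDiff (n := 1)).comp (contDiff_const_smul s)).differentiable one_ne_zero) y
  rw [fderiv_fun_mul ha hb, fderiv_comp_smul s, ContinuousLinearMap.fderiv]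
  simp only [add_apply, FunLike.coe_smul, Pi.smul_apply, smul_eq_mul, EuclideanSpace.coe_proj]
  have he : (EuclideanSpace.single (0 : Fin 1) (1 : ℝ)) 0 = 1 := by simp
  rw [he]
  ring

/-- `ψ_s(y) = 1` once `‖s y‖ < rIn` (`χ ≡ 1` near `s y`). [folklore] -/
theorem linearTestLimit_fderiv_profile_eq_one (χ : ContDiffBump (0 : EuclideanSpace ℝ (Fin 1)))
    {s : ℝ} {y : EuclideanSpace ℝ (Fin 1)} (h : ‖s • y‖ < χ.rIn) :
    fderiv ℝ (fun z : EuclideanSpace ℝ (Fin 1) =>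
        EuclideanSpace.proj (𝕜 := ℝ) (0 : Fin 1) z * (χ : EuclideanSpace ℝ (Fin 1) → ℝ) (s • z)) y
      (EuclideanSpace.single (0 : Fin 1) (1 : ℝ)) = 1 := by
  have hball : s • y ∈ Metric.ball (0 : EuclideanSpace ℝ (Fin 1)) χ.rIn := by
    rw [Metric.mem_ball, dist_zero_right]
    exact h
  have hχ1 : (χ : EuclideanSpace ℝ (Fin 1) → ℝ) (s • y) = 1 :=
    χ.one_of_mem_closedBall (Metric.ball_subset_closedBall hball)
  have hχ' : fderiv ℝ (χ : EuclideanSpace ℝ (Fin 1) → ℝ) (s • y) = 0 := by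
    rw [(χ.eventuallyEq_one_of_mem_ball hball).fderiv_eq]
    exact fderiv_const_apply (1 : ℝ)
  rw [linearTestLimit_fderiv_profile, hχ1, hχ']
  simp

/-- **Uniform bound** `|ψ_s(y)| ≤ 1 + rOut ‖χ'‖_∞` for all `s > 0` and `y` (on the support of
`χ'(s ·)` one has `s |y| ≤ rOut`). [folklore] -/
theorem linearTestLimit_exists_bound (χ : ContDiffBump (0 : EuclideanSpace ℝ (Fin 1))) :
    ∃ B : ℝ, 0 ≤ B ∧ ∀ s : ℝ, 0 < s → ∀ y : EuclideanSpace ℝ (Fin 1),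
      |fderiv ℝ (fun z : EuclideanSpace ℝ (Fin 1) =>
          EuclideanSpace.proj (𝕜 := ℝ) (0 : Fin 1) z * (χ : EuclideanSpace ℝ (Fin 1) → ℝ) (s • z)) y
        (EuclideanSpace.single (0 : Fin 1) (1 : ℝ))| ≤ B := by
  obtain ⟨M, hM⟩ :=
    ((χ.contDiff (n := 1)).continuous_fderiv one_ne_zero).bounded_above_of_compact_support
      (χ.hasCompactSupport.fderiv (𝕜 := ℝ))
  have hM0 : 0 ≤ M := (norm_nonneg _).trans (hM 0)
  have hR0 : 0 ≤ χ.rOut := χ.rOut_pos.le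
  refine ⟨1 + χ.rOut * M, by positivity, fun s hs y => ?_⟩
  rw [linearTestLimit_fderiv_profile]
  have h1 : |(χ : EuclideanSpace ℝ (Fin 1) → ℝ) (s • y)| ≤ 1 := by
    rw [abs_of_nonneg (χ.nonneg' _)]
    exact χ.le_one
  have h2 : |y 0 * (s * fderiv ℝ (χ : EuclideanSpace ℝ (Fin 1) → ℝ) (s • y)
      (EuclideanSpace.single (0 : Fin 1) (1 : ℝ)))| ≤ χ.rOut * M := by
    by_cases hy : ‖s • y‖ ≤ χ.rOut
    · have hy0 : |y 0| ≤ ‖y‖ := by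
        have h := PiLp.norm_apply_le y 0
        rwa [Real.norm_eq_abs] at h
      have hsy : s * ‖y‖ ≤ χ.rOut := by
        rwa [norm_smul, Real.norm_eq_abs, abs_of_pos hs] at hy
      have hD : |fderiv ℝ (χ : EuclideanSpace ℝ (Fin 1) → ℝ) (s • y)
          (EuclideanSpace.single (0 : Fin 1) (1 : ℝ))| ≤ M := by
        rw [← Real.norm_eq_abs]
        have he : ‖EuclideanSpace.single (0 : Fin 1) (1 : ℝ)‖ = 1 := by simp
        calc ‖fderiv ℝ (χ : EuclideanSpace ℝ (Fin 1) → ℝ) (s • y)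
              (EuclideanSpace.single (0 : Fin 1) (1 : ℝ))‖
            ≤ ‖fderiv ℝ (χ : EuclideanSpace ℝ (Fin 1) → ℝ) (s • y)‖ *
                ‖EuclideanSpace.single (0 : Fin 1) (1 : ℝ)‖ := ContinuousLinearMap.le_opNorm _ _
          _ ≤ M := by
              rw [he, mul_one]
              exact hM _
      rw [abs_mul, abs_mul, abs_of_pos hs]
      calc |y 0| * (s * |fderiv ℝ (χ : EuclideanSpace ℝ (Fin 1) → ℝ) (s • y)
              (EuclideanSpace.single (0 : Fin 1) (1 : ℝ))|)
          ≤ ‖y‖ * (s * M) :=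
            mul_le_mul hy0 (mul_le_mul_of_nonneg_left hD hs.le) (by positivity) (norm_nonneg _)
        _ = (s * ‖y‖) * M := by ring
        _ ≤ χ.rOut * M := mul_le_mul_of_nonneg_right hsy hM0
    · have hD : fderiv ℝ (χ : EuclideanSpace ℝ (Fin 1) → ℝ) (s • y) = 0 := by
        refine image_eq_zero_of_notMem_tsupport fun hmem => hy ?_
        have h' : s • y ∈ tsupport (χ : EuclideanSpace ℝ (Fin 1) → ℝ) :=
          tsupport_fderiv_subset ℝ hmem
        rw [χ.tsupport_eq, Metric.mem_closedBall, dist_zero_right] at h'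
        exact h'
      rw [hD, zero_apply, mul_zero, mul_zero, abs_zero]
      positivity
  exact (abs_add_le _ _).trans (add_le_add h1 h2)

/-! ## The cut-off cylindrical functionals `Φ_s(v) = φ_s((v, w))` -/

/-- The coefficient `v ↦ ψ_s((v, w))` is continuous on `H` (`φ_s ∈ C¹`, `(·, w)` continuous). [folklore] -/
theorem linearTestLimit_continuous_coeff {w : Vec3} (hw : Torus.IsSmooth w)
    (χ : ContDiffBump (0 : EuclideanSpace ℝ (Fin 1))) (s : ℝ) :
    Continuous fun v : H3 =>
      fderiv ℝ (fun z : EuclideanSpace ℝ (Fin 1) =>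
          EuclideanSpace.proj (𝕜 := ℝ) (0 : Fin 1) z * (χ : EuclideanSpace ℝ (Fin 1) → ℝ) (s • z))
        (WithLp.toLp 2 fun _ : Fin 1 => Torus.pairing (v : L2) w)
        (EuclideanSpace.single (0 : Fin 1) (1 : ℝ)) := by
  have hP : Continuous fun v : H3 => WithLp.toLp 2 fun _ : Fin 1 => Torus.pairing (v : L2) w :=
    (PiLp.continuous_toLp 2 _).comp
      (continuous_pi fun _ => Torus.continuous_pairing_coe (hw.memLp 2))
  exact (((linearTestLimit_contDiff_profile χ s).continuous_fderiv one_ne_zero).comp hP).clm_apply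
    continuous_const

/-- **The cut-off functional.** For `w ∈ 𝒱`, `s ≠ 0` and an integrable force `f` there is a
cylindrical `Φ_s` (one coordinate `(·, w)`, profile `φ_s`) with `Φ_s'(v) = ψ_s((v, w)) w` and
`⟨F₀(v), Φ_s'(v)⟩ = ψ_s((v, w)) ⟨F₀(v), w⟩` (`Torus.nsGeneratorPairing_grad`). [folklore] -/
theorem linearTestLimit_exists_test {f w : Vec3} (hf : Integrable f volume) (hw : Torus.IsSmooth w)
    (hdw : Torus.IsDivFree w) (hzw : Torus.HasZeroMean w)
    (χ : ContDiffBump (0 : EuclideanSpace ℝ (Fin 1))) {s : ℝ} (hs : s ≠ 0) :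
    ∃ Φ : Torus.CylindricalTest (Fin 3), ∀ v : H3,
      (Φ.grad v = fun x =>
        fderiv ℝ (fun z : EuclideanSpace ℝ (Fin 1) =>
            EuclideanSpace.proj (𝕜 := ℝ) (0 : Fin 1) z * (χ : EuclideanSpace ℝ (Fin 1) → ℝ) (s • z))
          (WithLp.toLp 2 fun _ : Fin 1 => Torus.pairing (v : L2) w)
          (EuclideanSpace.single (0 : Fin 1) (1 : ℝ)) • w x) ∧
      Torus.nsGeneratorPairing 0 f v (Φ.grad v) =
        fderiv ℝ (fun z : EuclideanSpace ℝ (Fin 1) =>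
            EuclideanSpace.proj (𝕜 := ℝ) (0 : Fin 1) z * (χ : EuclideanSpace ℝ (Fin 1) → ℝ) (s • z))
          (WithLp.toLp 2 fun _ : Fin 1 => Torus.pairing (v : L2) w)
          (EuclideanSpace.single (0 : Fin 1) (1 : ℝ)) * Torus.nsGeneratorPairing 0 f v w := by
  let Φ : Torus.CylindricalTest (Fin 3) :=
    { m := 1
      g := fun _ => w
      g_smooth := fun _ => hw
      g_divFree := fun _ => hdw
      g_zeroMean := fun _ => hzw
      φ := fun z => EuclideanSpace.proj (𝕜 := ℝ) (0 : Fin 1) z * (χ : EuclideanSpace ℝ (Fin 1) → ℝ) (s • z)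
      φ_contDiff := linearTestLimit_contDiff_profile χ s
      φ_compact := linearTestLimit_hasCompactSupport_profile χ hs }
  have hgrad : ∀ v : H3, Φ.grad v = fun x =>
      fderiv ℝ (fun z : EuclideanSpace ℝ (Fin 1) =>
          EuclideanSpace.proj (𝕜 := ℝ) (0 : Fin 1) z * (χ : EuclideanSpace ℝ (Fin 1) → ℝ) (s • z))
        (WithLp.toLp 2 fun _ : Fin 1 => Torus.pairing (v : L2) w)
        (EuclideanSpace.single (0 : Fin 1) (1 : ℝ)) • w x := by
    intro v
    funext x
    change ∑ i : Fin 1, fderiv ℝ (fun z : EuclideanSpace ℝ (Fin 1) =>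
        EuclideanSpace.proj (𝕜 := ℝ) (0 : Fin 1) z * (χ : EuclideanSpace ℝ (Fin 1) → ℝ) (s • z))
      (WithLp.toLp 2 fun _ : Fin 1 => Torus.pairing (v : L2) w) (EuclideanSpace.single i (1 : ℝ)) • w x = _
    rw [Fin.sum_univ_one]
  refine ⟨Φ, fun v => ⟨hgrad v, ?_⟩⟩
  rw [Torus.nsGeneratorPairing_grad 0 hf]
  change ∑ i : Fin 1, fderiv ℝ (fun z : EuclideanSpace ℝ (Fin 1) =>
      EuclideanSpace.proj (𝕜 := ℝ) (0 : Fin 1) z * (χ : EuclideanSpace ℝ (Fin 1) → ℝ) (s • z))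
    (WithLp.toLp 2 fun _ : Fin 1 => Torus.pairing (v : L2) w) (EuclideanSpace.single i (1 : ℝ)) *
      Torus.nsGeneratorPairing 0 f v w = _
  rw [Fin.sum_univ_one]

/-! ## The stub -/

/-- **L `stub_linearTestLimit`** — REMOVING THE CUT-OFF. For a probability measure `μ` on `H` with
`∫ |v|² dμ < ∞`, a force `f ∈ L²` and a fixed smooth solenoidal mean-zero field `w`: if the cylindrical
forced-Euler defect of `μ` is at most `R` (against EVERY cylindrical `Φ`), then the fixed-test balance
`|∫ ⟨f − B(v,v), w⟩ dμ| ≤ R ‖∇w‖₂` holds (`v ↦ ⟨f − B(v,v), w⟩` being `μ`-integrable, `|·| ≤ K(1+|v|²)`).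
Proof: cylindrical `Φₙ` with the one coordinate `(·, w)` and profile `y ↦ y₀ χ(y/(n+1))` (`χ` a `C^∞`
bump, `≡ 1` on the unit ball): `Φₙ'(v) = ψₙ((v,w)) w` with `|ψₙ| ≤ 1 + 2‖χ'‖_∞` and `ψₙ((v,w)) → 1`;
dominated convergence on both sides of the defect inequality. [folklore] -/
theorem stub_linearTestLimit (f w : Vec3) (hf : MemLp f 2 volume) (hw : Torus.IsSmooth w)
    (hdw : Torus.IsDivFree w) (hzw : Torus.HasZeroMean w) (μ : Measure H3) (hμ : IsProbabilityMeasure μ)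
    (hint : Integrable (fun v : H3 => ‖v‖ ^ 2) μ) (R : ℝ)
    (hdef : ∀ Φ : Torus.CylindricalTest (Fin 3),
      Integrable (fun v : H3 => Torus.nsGeneratorPairing 0 f v (Φ.grad v)) μ ∧
        |∫ v, Torus.nsGeneratorPairing 0 f v (Φ.grad v) ∂μ| ≤
          R * Real.sqrt (∫ v, Torus.gradNormSq (Φ.grad v) ∂μ)) :
    Integrable (fun v : H3 => Torus.nsGeneratorPairing 0 f v w) μ ∧
      |∫ v, Torus.nsGeneratorPairing 0 f v w ∂μ| ≤ R * Real.sqrt (Torus.gradNormSq w) := by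
  -- the tested generator against the fixed field
  set K : H3 → ℝ := fun v => Torus.nsGeneratorPairing 0 f v w with hK
  have hKc : Continuous K := Torus.continuous_nsGeneratorPairing 0 f hw
  obtain ⟨K₀, -, hK₀⟩ := Torus.exists_abs_nsGeneratorPairing_le 0 f hw
  have hKi : Integrable K μ := by
    refine Integrable.mono' (((integrable_const (1 : ℝ)).add hint).const_mul K₀) hKc.aestronglyMeasurable
      (ae_of_all _ fun v => ?_)
    rw [Real.norm_eq_abs]
    exact hK₀ v
  refine ⟨hKi, ?_⟩
  -- the bump, the coordinate map and the cut-off coefficients along `s = 1/(n+1)`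
  have hf1 : Integrable f volume := hf.integrable one_le_two
  set χ : ContDiffBump (0 : EuclideanSpace ℝ (Fin 1)) := ⟨1, 2, one_pos, one_lt_two⟩ with hχ
  set P : H3 → EuclideanSpace ℝ (Fin 1) := fun v =>
    WithLp.toLp 2 fun _ : Fin 1 => Torus.pairing (v : L2) w with hP
  set sq : ℕ → ℝ := fun n => 1 / ((n : ℝ) + 1) with hsq
  have hsq_pos : ∀ n, 0 < sq n := fun n => by
    rw [hsq]
    positivity
  set c : ℕ → H3 → ℝ := fun n v =>
    fderiv ℝ (fun z : EuclideanSpace ℝ (Fin 1) =>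
        EuclideanSpace.proj (𝕜 := ℝ) (0 : Fin 1) z * (χ : EuclideanSpace ℝ (Fin 1) → ℝ) (sq n • z))
      (P v) (EuclideanSpace.single (0 : Fin 1) (1 : ℝ)) with hc
  obtain ⟨B, hB0, hB⟩ := linearTestLimit_exists_bound χ
  have hcB : ∀ n v, |c n v| ≤ B := fun n v => hB (sq n) (hsq_pos n) (P v)
  have hcc : ∀ n, Continuous (c n) := fun n => linearTestLimit_continuous_coeff hw χ (sq n)
  have hc1 : ∀ v : H3, ∀ᶠ n in atTop, c n v = 1 := by
    intro v
    refine Filter.eventually_atTop.2 ⟨⌈‖P v‖⌉₊, fun n hn => ?_⟩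
    refine linearTestLimit_fderiv_profile_eq_one χ ?_
    have hn' : ‖P v‖ ≤ n := (Nat.le_ceil _).trans (by exact_mod_cast hn)
    rw [norm_smul, Real.norm_eq_abs, abs_of_pos (hsq_pos n), hsq]
    change 1 / ((n : ℝ) + 1) * ‖P v‖ < 1
    rw [one_div, inv_mul_lt_iff₀ (by positivity : (0 : ℝ) < (n : ℝ) + 1)]
    linarith
  -- the defect inequality for `Φₙ`, rewritten
  have hineq : ∀ n, |∫ v, c n v * K v ∂μ| ≤
      R * Real.sqrt (∫ v, (c n v) ^ 2 * Torus.gradNormSq w ∂μ) := by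
    intro n
    obtain ⟨Φ, hΦ⟩ := linearTestLimit_exists_test hf1 hw hdw hzw χ (hsq_pos n).ne'
    have h := (hdef Φ).2
    have hg : ∀ v : H3, Torus.gradNormSq (Φ.grad v) = (c n v) ^ 2 * Torus.gradNormSq w := fun v => by
      rw [(hΦ v).1, linearTestLimit_gradNormSq_const_smul]
    simp_rw [fun v => (hΦ v).2, hg] at h
    exact h
  -- dominated convergence on the left
  have hlimL : Tendsto (fun n => ∫ v, c n v * K v ∂μ) atTop (𝓝 (∫ v, K v ∂μ)) := by
    refine tendsto_integral_of_dominated_convergence (fun v => B * ‖K v‖)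
      (fun n => ((hcc n).mul hKc).aestronglyMeasurable) (hKi.norm.const_mul B)
      (fun n => ae_of_all _ fun v => ?_) (ae_of_all _ fun v => ?_)
    · rw [norm_mul, Real.norm_eq_abs]
      exact mul_le_mul_of_nonneg_right (hcB n v) (norm_nonneg _)
    · refine tendsto_const_nhds.congr' ?_
      filter_upwards [hc1 v] with n hn
      rw [hn, one_mul]
  -- dominated convergence on the right
  have hlimR : Tendsto (fun n => ∫ v, (c n v) ^ 2 * Torus.gradNormSq w ∂μ) atTop
      (𝓝 (∫ _v, Torus.gradNormSq w ∂μ)) := by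
    refine tendsto_integral_of_dominated_convergence (fun _ => B ^ 2 * Torus.gradNormSq w)
      (fun n => (((hcc n).pow 2).mul continuous_const).aestronglyMeasurable) (integrable_const _)
      (fun n => ae_of_all _ fun v => ?_) (ae_of_all _ fun v => ?_)
    · rw [Real.norm_eq_abs, abs_mul, abs_of_nonneg (sq_nonneg _),
        abs_of_nonneg (Torus.gradNormSq_nonneg w)]
      refine mul_le_mul_of_nonneg_right ?_ (Torus.gradNormSq_nonneg w)
      rw [← sq_abs]
      exact pow_le_pow_left₀ (abs_nonneg _) (hcB n v) 2
    · refine tendsto_const_nhds.congr' ?_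
      filter_upwards [hc1 v] with n hn
      rw [hn, one_pow, one_mul]
  have hconst : ∫ _v, Torus.gradNormSq w ∂μ = Torus.gradNormSq w := by
    rw [integral_const, probReal_univ, one_smul]
  rw [hconst] at hlimR
  exact le_of_tendsto_of_tendsto' hlimL.abs ((hlimR.sqrt).const_mul R) hineq

end Summit.AnomalousDissipation.AnomalousDissipation.Theorems.EnsembleRigidity.GPStatisticalRigidity

end
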